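import Summits.CriticalPhenomena.PercolationContinuityZ3.Theorems.SahiMasterFamilyFCombTwoLevelKleitmanHall
import Summits.CriticalPhenomena.PercolationContinuityZ3.Theorems.SahiMasterFamilyFCombCubeTransfer
import Summits.CriticalPhenomena.PercolationContinuityZ3.Theorems.SahiMasterFamilyFCombUpwardHall

/-!
# LEMMA I** on a ground finset and the two-level data of SCHEME Σ (support file)

Support file (prover seat `prim-bnk-2`, gen 31; `--supports stmt-CriticalPhenomena-4575`).  Memo / proof document:
`run/shared/lean/prim/prim-l12/FROM-prim-bnk-2-g31-COMPRESSION-THEOREM.md` §6 and `run/shared/lean/prim/prim-l12/prim-bnk-2/PROOF-THEOREM-I1.md` §1.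

1. `twoLevel_kleitmanHall` (file `…TwoLevelKleitmanHall`) is LEMMA I** for up-sets `P ⊆ Q` of the cube of a finite TYPE.  SCHEME Σ needs it
   on the sub-cubes `2^R` (`R = I \ y_I`, `R = J \ w`) of the ground type; **`twoLevel_kleitmanHall_ground`** transfers it along the
   cube-transfer kit (`…CubeTransfer`): for `P ⊆ Q` families of subsets of a finset `R`, up-closed inside `2^R`, `l` enumerating `R`,
   `A = D_l (Q \ P)` is down-closed, `A ⊆ σ_R Q`, `A ∩ P = ∅`, and there are bijections `g : A ≃ Q \ P` (`z ⊆ g z`), `h : σ_R Q \ A ≃ P`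
   (`y ⊆ h y`), `σ_R = R \ ·`.
2. **`twoLevel_data`**: with the classes `a = σQ \ P`, `b = P \ σQ`, `c = σP \ Q`, `d = Q \ σP`, `Δ = Q \ P` and `T = σA`, the five upward
   bijections of PROOF-THEOREM-I1 §1 — `τ : A ≅↑ Δ`, `G_b : a \ A ≅↑ b`, `G_T : A ≅↑ T`, `Φ_c : c ≅↑ d \ T`, `Φ_ℓ : σΔ ≅↑ T` — by the
   ≅↑-calculus of `…FCombUpwardHall` (cancellation, σ-duality, gluing) and Kleitman for a down-set
   (`exists_dominating_equiv_image_sdiff_of_downClosed`).  Applied to `(C⁰|_{J∖w} ⊆ C¹|_{J∖w})` it gives the J-side data `A_w, M_w, G′_w, Φ′_w`.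
No definitions; no `sorry`; standard axioms.
-/

namespace Summit.CriticalPhenomena.PercolationContinuityZ3.Theorems

namespace SahiFComb.Shift

open Finset FinsetFamily

variable {α : Type*} [DecidableEq α]

/-! ### 1. LEMMA I** on a ground finset -/

/-- Dominating bijections descend from the subtype cube (variant with the two families given by their restrictions). -/
private theorem exists_dominating_equiv_of_resFam_eq (R : Finset α) {X Y : Finset (Finset α)}
    (hX : ∀ s ∈ X, s ⊆ R) (hY : ∀ s ∈ Y, s ⊆ R) {X' Y' : Finset (Finset ↥R)} (hX' : resFam R X = X') (hY' : resFam R Y = Y')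
    (h : ∃ e : ↥X' ≃ ↥Y', ∀ x : ↥X', (x : Finset ↥R) ⊆ (e x : Finset ↥R)) :
    ∃ e : ↥X ≃ ↥Y, ∀ x : ↥X, (x : Finset α) ⊆ (e x : Finset α) := by
  subst hX' hY'
  exact exists_dominating_equiv_of_resFam R hX hY h

/-- **LEMMA I** on a ground finset.**  Let `R` be a finset, `P ⊆ Q` families of subsets of `R` which are up-closed inside `2^R`,
`l` a duplicate-free list enumerating `R`, and `A = D_l (Q \ P)`.  Then `A` is down-closed, `A ⊆ σ_R Q`, `A ∩ P = ∅`, and there are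
bijections `g : A ≃ Q \ P` with `z ⊆ g z` and `h : σ_R Q \ A ≃ P` with `y ⊆ h y` (`σ_R s = R \ s`).  Equivalently
`T = σ_R A = U_l (Q \ P)` is an up-set of `2^R` inside `Q \ σ_R P` with `|T| = |Q \ P|`, `σ_R(Q \ P) ≅↑ T`, `σ_R P ≅↑ Q \ T`. [this work] -/
theorem twoLevel_kleitmanHall_ground [LinearOrder α] (R : Finset α) (P Q : Finset (Finset α))
    (hQR : ∀ s ∈ Q, s ⊆ R)
    (hP : ∀ K ∈ P, ∀ K', K ⊆ K' → K' ⊆ R → K' ∈ P) (hQ : ∀ K ∈ Q, ∀ K', K ⊆ K' → K' ⊆ R → K' ∈ Q) (hPQ : P ⊆ Q)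
    (l : List α) (hl : l.Nodup) (hlR : ∀ a ∈ l, a ∈ R) (hRl : ∀ a ∈ R, a ∈ l)
    (A : Finset (Finset α)) (hA : A = l.foldl (fun 𝒴 i => 𝓓 i 𝒴) (Q \ P)) :
    (∀ K ∈ A, ∀ K' ⊆ K, K' ∈ A) ∧ A ⊆ Q.image (fun s => R \ s) ∧ Disjoint A P ∧
      (∃ g : ↥A ≃ ↥(Q \ P), ∀ z : ↥A, (z : Finset α) ⊆ ((g z : ↥(Q \ P)) : Finset α)) ∧
      (∃ h : ↥(Q.image (fun s => R \ s) \ A) ≃ ↥P,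
        ∀ y : ↥(Q.image (fun s => R \ s) \ A), (y : Finset α) ⊆ ((h y : ↥P) : Finset α)) := by
  have hPR : ∀ s ∈ P, s ⊆ R := fun s hs => hQR s (hPQ hs)
  have hQPR : ∀ s ∈ Q \ P, s ⊆ R := fun s hs => hQR s (mem_sdiff.1 hs).1
  have hAR : ∀ s ∈ A, s ⊆ R := hA ▸ subset_ground_of_mem_downs R l hQPR
  have hσQR : ∀ s ∈ Q.image (fun s => R \ s), s ⊆ R := by
    intro s hs
    obtain ⟨t, -, rfl⟩ := mem_image.1 hs
    exact sdiff_subset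
  -- transferred data on the cube of `↥R`
  set l' : List ↥R := l.pmap (fun a h => (⟨a, h⟩ : ↥R)) hlR with hl'
  have hP' : ∀ K ∈ resFam R P, ∀ K', K ⊆ K' → K' ∈ resFam R P := upClosed_resFam R hPR hP
  have hQ' : ∀ K ∈ resFam R Q, ∀ K', K ⊆ K' → K' ∈ resFam R Q := upClosed_resFam R hQR hQ
  have hPQ' : resFam R P ⊆ resFam R Q := image_subset_image hPQ
  have hA' : resFam R A = l'.foldl (fun 𝒴 i => 𝓓 i 𝒴) (resFam R Q \ resFam R P) := by
    rw [hA, resFam_downs R l hlR hQPR, resFam_sdiff R hQR hPR]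
  obtain ⟨h1, h2, h3, h4, h5⟩ := twoLevel_kleitmanHall (resFam R P) (resFam R Q) hP' hQ' hPQ' l'
    (nodup_pmap_mk R hl hlR) (mem_pmap_mk R hlR hRl) (resFam R A) hA'
  refine ⟨downClosed_of_resFam R hAR h1, ?_, ?_, ?_, ?_⟩
  · -- `A ⊆ σ_R Q`
    intro s hs
    have h := h2 ((subtype_mem_resFam_iff R hAR (hAR s hs)).2 hs)
    rw [← resFam_image_sdiff] at h
    exact (subtype_mem_resFam_iff R (hσQR) (hAR s hs)).1 h
  · -- `A ∩ P = ∅`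
    refine disjoint_left.2 fun s hsA hsP => ?_
    exact disjoint_left.1 h3 ((subtype_mem_resFam_iff R hAR (hAR s hsA)).2 hsA)
      ((subtype_mem_resFam_iff R hPR (hAR s hsA)).2 hsP)
  · -- `g`
    exact exists_dominating_equiv_of_resFam_eq R hAR hQPR rfl (resFam_sdiff R hQR hPR) h4
  · -- `h`
    refine exists_dominating_equiv_of_resFam_eq R (fun s hs => hσQR s (mem_sdiff.1 hs).1) hPR ?_ rfl h5
    rw [resFam_sdiff R hσQR hAR, resFam_image_sdiff]

/-! ### 2. Relative complements of families -/

/-- Membership in the family of relative complements. [folklore] -/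
theorem mem_image_ground_sdiff (R : Finset α) {X : Finset (Finset α)} (hX : ∀ s ∈ X, s ⊆ R) {s : Finset α} :
    s ∈ X.image (fun t => R \ t) ↔ s ⊆ R ∧ R \ s ∈ X := by
  rw [mem_image]
  constructor
  · rintro ⟨t, ht, rfl⟩
    refine ⟨sdiff_subset, ?_⟩
    rwa [sdiff_sdiff_right_self, inf_eq_inter, inter_eq_right.2 (hX t ht)]
  · rintro ⟨hs, h⟩
    refine ⟨R \ s, h, ?_⟩
    rw [sdiff_sdiff_right_self, inf_eq_inter, inter_eq_right.2 hs]

/-- `σσ = id` on families of subsets of `R`. [folklore] -/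
theorem image_ground_sdiff_image_ground_sdiff (R : Finset α) {X : Finset (Finset α)} (hX : ∀ s ∈ X, s ⊆ R) :
    (X.image (fun t => R \ t)).image (fun t => R \ t) = X := by
  ext s
  rw [mem_image_ground_sdiff R (fun t ht => ((mem_image_ground_sdiff R hX).1 ht).1)]
  constructor
  · rintro ⟨hs, h⟩
    obtain ⟨-, h2⟩ := (mem_image_ground_sdiff R hX).1 h
    rwa [sdiff_sdiff_right_self, inf_eq_inter, inter_eq_right.2 hs] at h2
  · intro hs
    refine ⟨hX s hs, (mem_image_ground_sdiff R hX).2 ⟨sdiff_subset, ?_⟩⟩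
    rwa [sdiff_sdiff_right_self, inf_eq_inter, inter_eq_right.2 (hX s hs)]

/-- `σ(X \ Y) = σX \ σY` for families of subsets of `R`. [folklore] -/
theorem image_ground_sdiff_sdiff (R : Finset α) {X Y : Finset (Finset α)} (hX : ∀ s ∈ X, s ⊆ R) (hY : ∀ s ∈ Y, s ⊆ R) :
    (X \ Y).image (fun t => R \ t) = X.image (fun t => R \ t) \ Y.image (fun t => R \ t) := by
  ext s
  rw [mem_image_ground_sdiff R (fun t ht => hX t (mem_sdiff.1 ht).1), mem_sdiff, mem_sdiff, mem_image_ground_sdiff R hX,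
    mem_image_ground_sdiff R hY]
  tauto

/-! ### 3. Kleitman for a down-set of a ground cube -/

/-- **Kleitman for a down-set** (upward-bijection form): a down-closed family `A` of subsets of `R` admits a bijection `A ≃ σ_R A` with
`x ⊆ e x` — Kleitman–Hall for the up-set `σA` on `A \ σA`, the identity on `A ∩ σA`, glued. [folklore; this form this work] -/
theorem exists_dominating_equiv_image_sdiff_of_downClosed [LinearOrder α] (R : Finset α) (A : Finset (Finset α))
    (hAR : ∀ s ∈ A, s ⊆ R) (hA : ∀ K ∈ A, ∀ K' ⊆ K, K' ∈ A) :
    ∃ e : ↥A ≃ ↥(A.image fun t => R \ t), ∀ x : ↥A, (x : Finset α) ⊆ (e x : Finset α) := by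
  set G : Finset (Finset α) := A.image (fun t => R \ t) with hG
  have hGR : ∀ s ∈ G, s ⊆ R := fun s hs => ((mem_image_ground_sdiff R hAR).1 hs).1
  have hGup : ∀ K ∈ G, ∀ K', K ⊆ K' → K' ⊆ R → K' ∈ G := by
    intro K hK K' hKK' hK'R
    rw [hG, mem_image_ground_sdiff R hAR] at hK ⊢
    exact ⟨hK'R, hA _ hK.2 _ (sdiff_subset_sdiff subset_rfl hKK')⟩
  have hσG : G.image (fun t => R \ t) = A := image_ground_sdiff_image_ground_sdiff R hAR
  -- Kleitman–Hall for `G` on the cube `2^R`: `A \ G ≅↑ G \ A`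
  obtain ⟨φ, hφ⟩ := exists_dominating_equiv_ground R G hGR hGup [] List.nodup_nil (fun _ h => absurd h List.not_mem_nil)
    (G.image (fun t => R \ t) ∩ G) rfl
  have hdom : G.image (fun t => R \ t) \ G = A \ G := by rw [hσG]
  have hcod : G \ (G.image (fun t => R \ t) ∩ G).image (fun t => R \ t) = G \ A := by
    rw [hσG]
    ext s
    rw [mem_sdiff, mem_sdiff, mem_image_ground_sdiff R (fun t ht => hAR t (mem_inter.1 ht).1), mem_inter]
    constructor
    · rintro ⟨hsG, h⟩
      refine ⟨hsG, fun hsA => h ⟨hGR s hsG, ?_, ?_⟩⟩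
      · exact ((mem_image_ground_sdiff R hAR).1 hsG).2
      · rw [hG, mem_image_ground_sdiff R hAR, sdiff_sdiff_right_self, inf_eq_inter, inter_eq_right.2 (hGR s hsG)]
        exact ⟨sdiff_subset, hsA⟩
    · rintro ⟨hsG, hsA⟩
      refine ⟨hsG, fun ⟨_, _, h3⟩ => hsA ?_⟩
      rw [hG, mem_image_ground_sdiff R hAR, sdiff_sdiff_right_self, inf_eq_inter, inter_eq_right.2 (hGR s hsG)] at h3
      exact h3.2
  have h1 : ∃ e : ↥(A \ G) ≃ ↥(G \ A), ∀ x : ↥(A \ G), (x : Finset α) ⊆ (e x : Finset α) := by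
    rw [← hdom, ← hcod]
    exact ⟨φ, hφ⟩
  -- the identity on `A ∩ G`, glued
  have h2 : ∃ e : ↥(A ∩ G) ≃ ↥(A ∩ G), ∀ x : ↥(A ∩ G), (x : Finset α) ⊆ (e x : Finset α) :=
    ⟨Equiv.refl _, fun x => subset_rfl⟩
  have h3 := exists_dominating_equiv_union (disjoint_sdiff_inter A G) (X₂ := A ∩ G) (Y₂ := A ∩ G)
    (disjoint_left.2 fun s hs hs' => (mem_sdiff.1 hs).2 (mem_inter.1 hs').1) h1 h2
  rwa [sdiff_union_inter, inter_comm, sdiff_union_inter] at h3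

/-! ### 4. The data -/

omit [DecidableEq α] in
/-- Transport of an upward bijection along equalities of the two families. -/
private theorem exists_dominating_equiv_congr {X X' Y Y' : Finset (Finset α)} (hX : X = X') (hY : Y = Y')
    (h : ∃ e : ↥X ≃ ↥Y, ∀ x : ↥X, (x : Finset α) ⊆ (e x : Finset α)) :
    ∃ e : ↥X' ≃ ↥Y', ∀ x : ↥X', (x : Finset α) ⊆ (e x : Finset α) := by
  subst hX hY; exact h

/-- **The two-level data of SCHEME Σ** (proof document §1).  For `P ⊆ Q` up-closed inside `2^R`, `l` enumerating `R`, `σ = R \ ·` and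
`A = D_l (Q \ P)`: `A ⊆ σQ \ P` (`= a`), `A` is down-closed, and there are upward bijections
`τ : A ≅↑ Q \ P`, `G_b : (σQ \ P) \ A ≅↑ P \ σQ`, `G_T : A ≅↑ σA`, `Φ_c : σP \ Q ≅↑ (Q \ σP) \ σA`, `Φ_ℓ : σ(Q \ P) ≅↑ σA`. [this work] -/
theorem twoLevel_data [LinearOrder α] (R : Finset α) (P Q : Finset (Finset α)) (hQR : ∀ s ∈ Q, s ⊆ R)
    (hP : ∀ K ∈ P, ∀ K', K ⊆ K' → K' ⊆ R → K' ∈ P) (hQ : ∀ K ∈ Q, ∀ K', K ⊆ K' → K' ⊆ R → K' ∈ Q) (hPQ : P ⊆ Q)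
    (l : List α) (hl : l.Nodup) (hlR : ∀ a ∈ l, a ∈ R) (hRl : ∀ a ∈ R, a ∈ l)
    (A : Finset (Finset α)) (hA : A = l.foldl (fun 𝒴 i => 𝓓 i 𝒴) (Q \ P)) :
    A ⊆ Q.image (fun t => R \ t) \ P ∧ (∀ K ∈ A, ∀ K' ⊆ K, K' ∈ A) ∧
      (∃ τ : ↥A ≃ ↥(Q \ P), ∀ x : ↥A, (x : Finset α) ⊆ (τ x : Finset α)) ∧
      (∃ G : ↥((Q.image (fun t => R \ t) \ P) \ A) ≃ ↥(P \ Q.image (fun t => R \ t)),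
        ∀ x : ↥((Q.image (fun t => R \ t) \ P) \ A), (x : Finset α) ⊆ (G x : Finset α)) ∧
      (∃ G : ↥A ≃ ↥(A.image fun t => R \ t), ∀ x : ↥A, (x : Finset α) ⊆ (G x : Finset α)) ∧
      (∃ Φ : ↥(P.image (fun t => R \ t) \ Q) ≃ ↥((Q \ P.image (fun t => R \ t)) \ A.image (fun t => R \ t)),
        ∀ x : ↥(P.image (fun t => R \ t) \ Q), (x : Finset α) ⊆ (Φ x : Finset α)) ∧
      (∃ Φ : ↥((Q \ P).image (fun t => R \ t)) ≃ ↥(A.image fun t => R \ t),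
        ∀ x : ↥((Q \ P).image (fun t => R \ t)), (x : Finset α) ⊆ (Φ x : Finset α)) := by
  have hPR : ∀ s ∈ P, s ⊆ R := fun s hs => hQR s (hPQ hs)
  have hσQR : ∀ s ∈ Q.image (fun t => R \ t), s ⊆ R := fun s hs => ((mem_image_ground_sdiff R hQR).1 hs).1
  have hσPR : ∀ s ∈ P.image (fun t => R \ t), s ⊆ R := fun s hs => ((mem_image_ground_sdiff R hPR).1 hs).1
  obtain ⟨hdown, hAσQ, hAP, ⟨g, hg⟩, hh⟩ :=
    twoLevel_kleitmanHall_ground R P Q hQR hP hQ hPQ l hl hlR hRl A hA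
  have hAR : ∀ s ∈ A, s ⊆ R := fun s hs => hσQR s (hAσQ hs)
  have hAa : A ⊆ Q.image (fun t => R \ t) \ P := fun s hs =>
    mem_sdiff.2 ⟨hAσQ hs, fun hsP => disjoint_left.1 hAP hs hsP⟩
  -- `G_b` by cancellation of `h`
  have hGb : ∃ G : ↥((Q.image (fun t => R \ t) \ P) \ A) ≃ ↥(P \ Q.image (fun t => R \ t)),
      ∀ x : ↥((Q.image (fun t => R \ t) \ P) \ A), (x : Finset α) ⊆ (G x : Finset α) := by
    refine exists_dominating_equiv_congr ?_ ?_ (exists_dominating_equiv_sdiff hh)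
    · ext s; simp only [mem_sdiff]; tauto
    · ext s
      simp only [mem_sdiff, not_and, not_not]
      constructor
      · rintro ⟨hsP, h⟩
        exact ⟨hsP, fun hsQ => disjoint_left.1 hAP (h hsQ) hsP⟩
      · rintro ⟨hsP, h⟩
        exact ⟨hsP, fun hsQ => absurd hsP (fun hsP => h hsQ)⟩
  -- `G_T` by Kleitman for the down-set `A`
  have hGT := exists_dominating_equiv_image_sdiff_of_downClosed R A hAR hdown
  refine ⟨hAa, hdown, ⟨g, hg⟩, hGb, hGT, ?_, ?_⟩
  · -- `Φ_c` = σ-dual of `G_b`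
    have hX : ∀ s ∈ (Q.image (fun t => R \ t) \ P) \ A, s ⊆ R := fun s hs =>
      hσQR s (mem_sdiff.1 (mem_sdiff.1 hs).1).1
    have hY : ∀ s ∈ P \ Q.image (fun t => R \ t), s ⊆ R := fun s hs => hPR s (mem_sdiff.1 hs).1
    refine exists_dominating_equiv_congr ?_ ?_ (exists_dominating_equiv_image_sdiff R hX hY hGb)
    · rw [image_ground_sdiff_sdiff R hPR hσQR, image_ground_sdiff_image_ground_sdiff R hQR]
    · rw [image_ground_sdiff_sdiff R (fun s hs => hσQR s (mem_sdiff.1 hs).1) hAR,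
        image_ground_sdiff_sdiff R hσQR hPR, image_ground_sdiff_image_ground_sdiff R hQR]
  · -- `Φ_ℓ` = σ-dual of `τ = g`
    have hY : ∀ s ∈ Q \ P, s ⊆ R := fun s hs => hQR s (mem_sdiff.1 hs).1
    exact exists_dominating_equiv_image_sdiff R hAR hY ⟨g, hg⟩

end SahiFComb.Shift

end Summit.CriticalPhenomena.PercolationContinuityZ3.Theorems
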